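import Mathlib
import Summits.KontsevichZagierPeriods.Zeta5Search.KSecondDigitTerms
import HarnessLib

/-!
# ζ(5) search — the CLASSWISE SECOND `𝒦`-DIGIT for classes of exponent `≤ −4` (DENOM-LAW D1, prover-d1 gen 19)

HONEST FRAMING: systematic search; no irrationality claim unless certified.  Cell `pub-zeta5`, track «DENOM-LAW» D1, seat
`denom-prover-d1` gen 19 (`HOME/denom-law/prover-d1/ATTEMPT-19.md` §2).  PART 2 of 2 (part 1 `KSecondDigitTerms.lean`: the termwise
estimates).  The `𝒦`-row analogue of gen-2 g10's (W2)
(`secondDigitW_holds`): for a window prime `p ≥ 5`, `b` in the polytope, and a pole class `x < p` with `E_x ≤ −4`,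

  **`‖𝒦_x − (−p)^{E_x+3} ĝ_x (ĉ_x − p φ_x ĉ₂_x)‖_p ≤ p^{−(E_x+5)}`**   (`secondDigitK`),

`𝒦_x = classK` (the class piece of `kRes`), `ĉ_x = cHat` (first `𝒦`-digit, gen-2 g9), `ĉ₂_x = cHat2` (`KDigitSecondFunctional`),
`ĝ_x = gHat`, `φ_x = phiHat` at the BASE `x` of the class.  gen-2 g10 (`g10/secdigit.py`) recorded the second `𝒦`-digit as «Fermat
quotients enter at this order»; they do enter TERMWISE (weights `g₀ = p²φ_k²`, `g₁ = 2pφ_k(1 − pk^{p−1})`, `g₂ − 1 ≡ −2pk^{p−1}`,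
`φ_{k+pℓ} ≡ φ_k − ℓ + pℓk^{p−1} (mod p²)`, `KDigitWeightsTwo`), but in the CLASS SUM the Fermat quotient `F = φ_{x+1}` of the base multiplies
only `Σρ₁`, `Σ(ρ₂ + ℓρ₁)`, `Σ(ρ₃ + 2ℓρ₂ + ℓ²ρ₁)` — the three residue identities `rhoResidueIdentities_holds`, all `0` when `E_x ≤ −4` —
and `k^{p−1}` multiplies `Σ(ρ₂+ℓρ₁)` and `Σ(ρ₃+2ℓρ₂+ℓ²ρ₁)` likewise (POINTWISE identity `kModel_eq`, checked by `ring`).  At `E_x = −3` the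
statement is false (`Σ(ρ₃+2ℓρ₂+ℓ²ρ₁) = 1`).  Exact check (`g19/code/kdig.py`): 1,429 / 1,429 classes with `E ≤ −4` (`p ≤ 7`, multipole
853, single-pole 576).  Ingredients: Theorem B to second order (`leadingDigit₂`), Theorem A (`clusterBound_holds`), `ĝ`/`φ` along the class
to second order (`padicNorm_gHat_sub_second_le`, `padicNorm_phiHat_sub_le`).  USE: the deep classes of THEOREM A‴ in `𝒦`-form (direction
`τ_K = 2ĉ₂ − Lĉ`).  `p`-adic valuations of rational numbers; nothing about ζ(5), no γ; records in print UNMOVED.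
-/

noncomputable section

open Finset

namespace Summit.KontsevichZagierPeriods.Zeta5Search.SecondOrder

open Summit.KontsevichZagierPeriods.Zeta5Search.WedgeDictionary (pfData)
open Summit.KontsevichZagierPeriods.Zeta5Search.CasoratianValuation (InPolytope)
open Summit.KontsevichZagierPeriods.Zeta5Search.ClusterValuation
open Summit.KontsevichZagierPeriods.Zeta5Search.PadicSeries
open Summit.KontsevichZagierPeriods.Zeta5Search.CellA (padicNorm_classRho_le_one pfData_eq_zero_of_order_le padicNorm_p nI_nat)
open Summit.KontsevichZagierPeriods.Zeta5Search.BigPrime (padicNorm_mul_le_one)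

variable {p : ℕ} [hp : Fact p.Prime]


/-! ### The point-to-base reduction (pure `p`-adic algebra on abstract atoms) -/

/-- **The point-to-base reduction (second order).**  Abstract form: atoms of norm `≤ 1` with `ĝ_s ≡ g(1 − ℓpφ) (p²)`,
`φ_s ≡ φ (p)`, `f ≡ F − ℓ + pℓκ (p²)`, `k^{p−1} ≡ κ (p)`; then the exact bracket
`ĝ_s·[(ρ₁ − pφ_sρ₂)f² − 2f(1 − pk^{p−1})(ρ₂ − pφ_sρ₃) − 2pκρ₃]` agrees to `O(p²)` with the BASE MODEL `g·(main₀ + p·main₁)`,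
`A := F − ℓ`, `main₀ = ρ₁A² − 2Aρ₂`, `main₁ = −ℓφ·main₀ − φρ₂A² + 2ℓκρ₁A − 2ℓκρ₂ + 2κAρ₂ + 2φAρ₃ − 2κρ₃`. -/
theorem model_reduction {g gs φ φs ρ1 ρ2 ρ3 ℓ F f κ kp : ℚ}
    (hg : padicNorm p g ≤ 1) (hφ : padicNorm p φ ≤ 1) (hφs : padicNorm p φs ≤ 1)
    (hρ1n : padicNorm p ρ1 ≤ 1) (hρ2n : padicNorm p ρ2 ≤ 1) (hρ3n : padicNorm p ρ3 ≤ 1) (hl : padicNorm p ℓ ≤ 1)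
    (hF : padicNorm p F ≤ 1) (hf : padicNorm p f ≤ 1) (hκn : padicNorm p κ ≤ 1) (hkpn : padicNorm p kp ≤ 1)
    (h_gs : padicNorm p (gs - g * (1 - ℓ * (p : ℚ) * φ)) ≤ (p : ℚ) ^ (-(2 : ℤ)))
    (h_φ : padicNorm p (φs - φ) ≤ (p : ℚ) ^ (-(1 : ℤ)))
    (h_f : padicNorm p (f - (F - ℓ + (p : ℚ) * ℓ * κ)) ≤ (p : ℚ) ^ (-(2 : ℤ)))
    (h_kp : padicNorm p (kp - κ) ≤ (p : ℚ) ^ (-(1 : ℤ))) :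
    padicNorm p (gs * ((ρ1 - (p : ℚ) * φs * ρ2) * f ^ 2 + -2 * f * (1 - (p : ℚ) * kp) * (ρ2 - (p : ℚ) * φs * ρ3)
        + -2 * (p : ℚ) * κ * ρ3)
      - g * ((ρ1 * (F - ℓ) ^ 2 - 2 * (F - ℓ) * ρ2) + (p : ℚ) * (-ℓ * φ * (ρ1 * (F - ℓ) ^ 2 - 2 * (F - ℓ) * ρ2)
          - φ * ρ2 * (F - ℓ) ^ 2 + 2 * ℓ * κ * ρ1 * (F - ℓ) - 2 * ℓ * κ * ρ2 + 2 * κ * (F - ℓ) * ρ2 + 2 * φ * (F - ℓ) * ρ3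
          - 2 * κ * ρ3)))
      ≤ (p : ℚ) ^ (-(2 : ℤ)) := by
  set P : ℚ := (p : ℚ) with hP
  have hPn : padicNorm p P ≤ 1 := nI_nat _
  have h2n : padicNorm p (2 : ℚ) ≤ 1 := by simpa using nI_nat (p := p) 2
  have h1n : padicNorm p (1 : ℚ) ≤ 1 := by simp
  have hAn : padicNorm p (F - ℓ) ≤ 1 := fo_sub hF hl
  have hp2nn : (0 : ℚ) ≤ (p : ℚ) ^ (-(2 : ℤ)) := zpow_p_nonneg _
  -- substituted quantities
  set B : ℚ := F - ℓ + P * ℓ * κ with hB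
  set u : ℚ := 1 - P * κ with hu
  have hBn : padicNorm p B ≤ 1 := fo_add hAn (padicNorm_mul_le_one (padicNorm_mul_le_one hPn hl) hκn)
  have hun : padicNorm p u ≤ 1 := fo_sub h1n (padicNorm_mul_le_one hPn hκn)
  -- part 1: `(ρ₁ − Pφ_sρ₂) f² ≈ (ρ₁ − Pφρ₂) B²`
  have hQ1 : padicNorm p ((ρ1 - P * φs * ρ2) - (ρ1 - P * φ * ρ2)) ≤ (p : ℚ) ^ (-(2 : ℤ)) := by
    have e : (ρ1 - P * φs * ρ2) - (ρ1 - P * φ * ρ2) = P * (-(ρ2 * (φs - φ))) := by ring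
    rw [e]
    have h : padicNorm p (-(ρ2 * (φs - φ))) ≤ (p : ℚ) ^ (-(1 : ℤ)) := by
      rw [padicNorm.neg]; exact padicNorm_mul_le_right hρ2n h_φ
    have := norm_p_mul_le (p := p) h
    rwa [show (-(1 : ℤ)) - 1 = -2 by norm_num] at this
  have hf2 : padicNorm p (f ^ 2 - B ^ 2) ≤ (p : ℚ) ^ (-(2 : ℤ)) := by
    rw [sq_sub_sq, padicNorm.mul]
    calc _ ≤ 1 * (p : ℚ) ^ (-(2 : ℤ)) := mul_le_mul (fo_add hf hBn) h_f (padicNorm.nonneg _) zero_le_one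
      _ = _ := one_mul _
  have part1 : padicNorm p ((ρ1 - P * φs * ρ2) * f ^ 2 - (ρ1 - P * φ * ρ2) * B ^ 2) ≤ (p : ℚ) ^ (-(2 : ℤ)) :=
    mul_sub_mul_le (fo_sub hρ1n (padicNorm_mul_le_one (padicNorm_mul_le_one hPn hφs) hρ2n))
      (by rw [pow_two]; exact padicNorm_mul_le_one hBn hBn) hQ1 hf2 hp2nn
  -- part 2: `f (1 − P kp) (ρ₂ − Pφ_sρ₃) ≈ B u (ρ₂ − Pφρ₃)`
  have hfu : padicNorm p (f * (1 - P * kp) - B * u) ≤ (p : ℚ) ^ (-(2 : ℤ)) := by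
    refine mul_sub_mul_le hf hun h_f ?_ hp2nn
    have e : (1 - P * kp) - u = P * (-(kp - κ)) := by rw [hu]; ring
    rw [e]
    have h : padicNorm p (-(kp - κ)) ≤ (p : ℚ) ^ (-(1 : ℤ)) := by rw [padicNorm.neg]; exact h_kp
    have := norm_p_mul_le (p := p) h
    rwa [show (-(1 : ℤ)) - 1 = -2 by norm_num] at this
  have hQ2 : padicNorm p ((ρ2 - P * φs * ρ3) - (ρ2 - P * φ * ρ3)) ≤ (p : ℚ) ^ (-(2 : ℤ)) := by
    have e : (ρ2 - P * φs * ρ3) - (ρ2 - P * φ * ρ3) = P * (-(ρ3 * (φs - φ))) := by ring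
    rw [e]
    have h : padicNorm p (-(ρ3 * (φs - φ))) ≤ (p : ℚ) ^ (-(1 : ℤ)) := by
      rw [padicNorm.neg]; exact padicNorm_mul_le_right hρ3n h_φ
    have := norm_p_mul_le (p := p) h
    rwa [show (-(1 : ℤ)) - 1 = -2 by norm_num] at this
  have part2 : padicNorm p (f * (1 - P * kp) * (ρ2 - P * φs * ρ3) - B * u * (ρ2 - P * φ * ρ3)) ≤ (p : ℚ) ^ (-(2 : ℤ)) :=
    mul_sub_mul_le (padicNorm_mul_le_one hf (fo_sub h1n (padicNorm_mul_le_one hPn hkpn)))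
      (fo_sub hρ2n (padicNorm_mul_le_one (padicNorm_mul_le_one hPn hφ) hρ3n)) hfu hQ2 hp2nn
  -- the exact bracket `BX` and the substituted bracket `BS`
  set BX : ℚ := (ρ1 - P * φs * ρ2) * f ^ 2 + -2 * f * (1 - P * kp) * (ρ2 - P * φs * ρ3) + -2 * P * κ * ρ3 with hBX
  set BS : ℚ := (ρ1 - P * φ * ρ2) * B ^ 2 + -2 * (B * u * (ρ2 - P * φ * ρ3)) + -2 * P * κ * ρ3 with hBS
  have hBXS : padicNorm p (BX - BS) ≤ (p : ℚ) ^ (-(2 : ℤ)) := by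
    have e : BX - BS = ((ρ1 - P * φs * ρ2) * f ^ 2 - (ρ1 - P * φ * ρ2) * B ^ 2)
        + -2 * (f * (1 - P * kp) * (ρ2 - P * φs * ρ3) - B * u * (ρ2 - P * φ * ρ3)) := by
      rw [hBX, hBS]; ring
    rw [e]
    exact fo_add part1 (by
      rw [padicNorm.mul, padicNorm.neg]
      calc _ ≤ 1 * (p : ℚ) ^ (-(2 : ℤ)) := mul_le_mul h2n part2 (padicNorm.nonneg _) zero_le_one
        _ = _ := one_mul _)
  have hBXn : padicNorm p BX ≤ 1 := by
    rw [hBX]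
    refine fo_add (fo_add ?_ ?_) ?_
    · exact padicNorm_mul_le_one (fo_sub hρ1n (padicNorm_mul_le_one (padicNorm_mul_le_one hPn hφs) hρ2n))
        (by rw [pow_two]; exact padicNorm_mul_le_one hf hf)
    · refine padicNorm_mul_le_one (padicNorm_mul_le_one (padicNorm_mul_le_one ?_ hf) (fo_sub h1n (padicNorm_mul_le_one hPn hkpn)))
        (fo_sub hρ2n (padicNorm_mul_le_one (padicNorm_mul_le_one hPn hφs) hρ3n))
      rw [padicNorm.neg]; exact h2n
    · refine padicNorm_mul_le_one (padicNorm_mul_le_one (padicNorm_mul_le_one ?_ hPn) hκn) hρ3n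
      rw [padicNorm.neg]; exact h2n
  -- the polynomial identity `BS = main₀ + P·m₁' + P²·R`
  set A : ℚ := F - ℓ with hA
  set main0 : ℚ := ρ1 * A ^ 2 - 2 * A * ρ2 with hmain0
  set m1 : ℚ := -(φ * ρ2 * A ^ 2) + 2 * ℓ * κ * ρ1 * A - 2 * ℓ * κ * ρ2 + 2 * κ * A * ρ2 + 2 * φ * A * ρ3 - 2 * κ * ρ3 with hm1
  set R : ℚ := ℓ ^ 2 * κ ^ 2 * ρ1 - 2 * φ * ℓ * κ * A * ρ2 + 2 * ℓ * κ ^ 2 * ρ2 - 2 * φ * κ * A * ρ3 + 2 * φ * ℓ * κ * ρ3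
    + P * (-(φ * ℓ ^ 2 * κ ^ 2 * ρ2) - 2 * φ * ℓ * κ ^ 2 * ρ3) with hR
  have hpoly : BS = main0 + P * m1 + P ^ 2 * R := by
    rw [hBS, hmain0, hm1, hR, hB, hu, hA]; ring
  have hm1n : padicNorm p m1 ≤ 1 := by
    rw [hm1]
    refine fo_sub (fo_add (fo_add (fo_sub (fo_add ?_ ?_) ?_) ?_) ?_) ?_
    · rw [padicNorm.neg]; exact padicNorm_mul_le_one (padicNorm_mul_le_one hφ hρ2n) (by rw [pow_two]; exact padicNorm_mul_le_one hAn hAn)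
    · exact padicNorm_mul_le_one (padicNorm_mul_le_one (padicNorm_mul_le_one (padicNorm_mul_le_one h2n hl) hκn) hρ1n) hAn
    · exact padicNorm_mul_le_one (padicNorm_mul_le_one (padicNorm_mul_le_one h2n hl) hκn) hρ2n
    · exact padicNorm_mul_le_one (padicNorm_mul_le_one (padicNorm_mul_le_one h2n hκn) hAn) hρ2n
    · exact padicNorm_mul_le_one (padicNorm_mul_le_one (padicNorm_mul_le_one h2n hφ) hAn) hρ3n
    · exact padicNorm_mul_le_one (padicNorm_mul_le_one h2n hκn) hρ3n
  have hRn : padicNorm p R ≤ 1 := by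
    rw [hR]
    have hκ2 : padicNorm p (κ ^ 2) ≤ 1 := by rw [pow_two]; exact padicNorm_mul_le_one hκn hκn
    have hl2 : padicNorm p (ℓ ^ 2) ≤ 1 := by rw [pow_two]; exact padicNorm_mul_le_one hl hl
    refine fo_add (fo_add (fo_sub (fo_add (fo_sub ?_ ?_) ?_) ?_) ?_) ?_
    · exact padicNorm_mul_le_one (padicNorm_mul_le_one hl2 hκ2) hρ1n
    · exact padicNorm_mul_le_one (padicNorm_mul_le_one (padicNorm_mul_le_one (padicNorm_mul_le_one (padicNorm_mul_le_one h2n hφ) hl) hκn) hAn) hρ2n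
    · exact padicNorm_mul_le_one (padicNorm_mul_le_one (padicNorm_mul_le_one h2n hl) hκ2) hρ2n
    · exact padicNorm_mul_le_one (padicNorm_mul_le_one (padicNorm_mul_le_one (padicNorm_mul_le_one h2n hφ) hκn) hAn) hρ3n
    · exact padicNorm_mul_le_one (padicNorm_mul_le_one (padicNorm_mul_le_one (padicNorm_mul_le_one h2n hφ) hl) hκn) hρ3n
    · refine padicNorm_mul_le_one hPn (fo_sub ?_ ?_)
      · rw [padicNorm.neg]; exact padicNorm_mul_le_one (padicNorm_mul_le_one (padicNorm_mul_le_one hφ hl2) hκ2) hρ2n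
      · exact padicNorm_mul_le_one (padicNorm_mul_le_one (padicNorm_mul_le_one (padicNorm_mul_le_one h2n hφ) hl) hκ2) hρ3n
  -- assemble
  have hg1n : padicNorm p (g * (1 - ℓ * P * φ)) ≤ 1 :=
    padicNorm_mul_le_one hg (fo_sub h1n (padicNorm_mul_le_one (padicNorm_mul_le_one hl hPn) hφ))
  have hP2 : padicNorm p (P ^ 2) ≤ (p : ℚ) ^ (-(2 : ℤ)) := padicNorm_p_sq_le
  have goal_eq : gs * ((ρ1 - P * φs * ρ2) * f ^ 2 + -2 * f * (1 - P * kp) * (ρ2 - P * φs * ρ3) + -2 * P * κ * ρ3)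
      - g * ((ρ1 * (F - ℓ) ^ 2 - 2 * (F - ℓ) * ρ2) + P * (-ℓ * φ * (ρ1 * (F - ℓ) ^ 2 - 2 * (F - ℓ) * ρ2)
          - φ * ρ2 * (F - ℓ) ^ 2 + 2 * ℓ * κ * ρ1 * (F - ℓ) - 2 * ℓ * κ * ρ2 + 2 * κ * (F - ℓ) * ρ2 + 2 * φ * (F - ℓ) * ρ3
          - 2 * κ * ρ3))
      = (gs - g * (1 - ℓ * P * φ)) * BX + g * (1 - ℓ * P * φ) * (BX - BS) + g * (1 - ℓ * P * φ) * (P ^ 2 * R)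
        - g * ℓ * φ * m1 * P ^ 2 := by
    rw [hpoly, hBX, hmain0, hm1, hA]; ring
  rw [goal_eq]
  refine fo_sub (fo_add (fo_add ?_ ?_) ?_) ?_
  · rw [padicNorm.mul]
    calc _ ≤ (p : ℚ) ^ (-(2 : ℤ)) * 1 := mul_le_mul h_gs hBXn (padicNorm.nonneg _) hp2nn
      _ = _ := mul_one _
  · exact padicNorm_mul_le_right hg1n hBXS
  · exact padicNorm_mul_le_right hg1n (padicNorm_mul_le_left hP2 hRn)
  · rw [padicNorm.mul]
    calc _ ≤ 1 * (p : ℚ) ^ (-(2 : ℤ)) :=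
          mul_le_mul (padicNorm_mul_le_one (padicNorm_mul_le_one (padicNorm_mul_le_one hg hl) hφ) hm1n) hP2 (padicNorm.nonneg _) zero_le_one
      _ = _ := one_mul _


/-! ### Assembly over the class -/

section Assembly

variable (b : ℕ → ℤ) (hb : InPolytope b) (hp5 : 5 ≤ p) (hwin : (b 0 + 2 : ℤ) < (p : ℤ) ^ 2)
  {x s : ℕ} (hx : x < p) (hs : s ∈ classSet b p x)
include hb hp5 hwin hx hs

/-- **All terms at one class point**: `‖Σ_o c_{o,s}(g_o − [o=2]) − (−p)^{E+3} ĝ_x·[s pole]·(main₀(s) + p·main₁(s))‖ ≤ p^{−(E+5)}`. -/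
theorem kTerm :
    padicNorm p ((∑ o ∈ range 6, pfData b o s * (((taylorTT p o ((s : ℤ) + 1) : ℤ) : ℚ) - if o = 2 then 1 else 0))
      - (-(p : ℚ)) ^ (classExp b p x + 3) * (gHat b p x *
        (if netExp b s < 0 then
          ((classRho b p s 1 * ((fq p ((x : ℤ) + 1) : ℚ) - ((s / p : ℕ) : ℚ)) ^ 2
              - 2 * ((fq p ((x : ℤ) + 1) : ℚ) - ((s / p : ℕ) : ℚ)) * (if netExp b s ≤ -2 then classRho b p s 2 else 0))
            + (p : ℚ) * (-((s / p : ℕ) : ℚ) * phiHat b p x *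
                (classRho b p s 1 * ((fq p ((x : ℤ) + 1) : ℚ) - ((s / p : ℕ) : ℚ)) ^ 2
                  - 2 * ((fq p ((x : ℤ) + 1) : ℚ) - ((s / p : ℕ) : ℚ)) * (if netExp b s ≤ -2 then classRho b p s 2 else 0))
              - phiHat b p x * (if netExp b s ≤ -2 then classRho b p s 2 else 0) * ((fq p ((x : ℤ) + 1) : ℚ) - ((s / p : ℕ) : ℚ)) ^ 2
              + 2 * ((s / p : ℕ) : ℚ) * ((((x : ℤ) + 1 : ℤ)) : ℚ) ^ (p - 1) * classRho b p s 1 * ((fq p ((x : ℤ) + 1) : ℚ) - ((s / p : ℕ) : ℚ))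
              - 2 * ((s / p : ℕ) : ℚ) * ((((x : ℤ) + 1 : ℤ)) : ℚ) ^ (p - 1) * (if netExp b s ≤ -2 then classRho b p s 2 else 0)
              + 2 * ((((x : ℤ) + 1 : ℤ)) : ℚ) ^ (p - 1) * ((fq p ((x : ℤ) + 1) : ℚ) - ((s / p : ℕ) : ℚ)) * (if netExp b s ≤ -2 then classRho b p s 2 else 0)
              + 2 * phiHat b p x * ((fq p ((x : ℤ) + 1) : ℚ) - ((s / p : ℕ) : ℚ)) * (if netExp b s ≤ -3 then classRho b p s 3 else 0)
              - 2 * ((((x : ℤ) + 1 : ℤ)) : ℚ) ^ (p - 1) * (if netExp b s ≤ -3 then classRho b p s 3 else 0)))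
         else 0))) ≤ (p : ℚ) ^ (-(classExp b p x + 5)) := by
  have hprime := hp.out
  have hp2 : p ≠ 2 := by omega
  have hp0 : (p : ℚ) ≠ 0 := Nat.cast_ne_zero.2 hprime.ne_zero
  have hsn : s ≤ (b 0).toNat := le_of_mem_classSet b hs
  set E := classExp b p x with hE
  by_cases hspole : netExp b s < 0
  · rw [if_pos hspole, ← add_sum_erase (range 6) _ (show 0 ∈ range 6 by simp),
      ← add_sum_erase ((range 6).erase 0) _ (show 1 ∈ (range 6).erase 0 by simp),
      ← add_sum_erase (((range 6).erase 0).erase 1) _ (show 2 ∈ ((range 6).erase 0).erase 1 by simp)]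
    set Rest := ∑ o ∈ (((range 6).erase 0).erase 1).erase 2,
      pfData b o s * (((taylorTT p o ((s : ℤ) + 1) : ℤ) : ℚ) - if o = 2 then 1 else 0) with hRest
    have hRestle : padicNorm p Rest ≤ (p : ℚ) ^ (-(E + 5)) := by
      refine padicNorm.sum_le' (fun o ho => ?_) (zpow_p_nonneg _)
      simp only [mem_erase, mem_range] at ho
      exact kTerm_high b hb hp5 hwin hs ho.2.2.2 (by omega)
    have h0 := kTerm_zero b hb hp5 hwin hx hs hspole
    have h1 := kTerm_one b hb hp5 hwin hx hs hspole
    have h2 := kTerm_two b hb hp5 hwin hx hs hspole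
    -- the base reduction
    obtain ⟨hgs, hg, hφs, hφ, hρ, hl, hf, hF⟩ := kTerm_norms b hb hp5 hwin hx hs
    have hlvl : ((s : ℤ) + 1) = ((x : ℤ) + 1) + (p : ℤ) * (((s / p : ℕ) : ℤ)) := succ_eq_succ_add_mul_lvl hx hs
    have hρ2n : padicNorm p (if netExp b s ≤ -2 then classRho b p s 2 else 0) ≤ 1 := by split_ifs; exacts [hρ 2, by simp]
    have hρ3n : padicNorm p (if netExp b s ≤ -3 then classRho b p s 3 else 0) ≤ 1 := by split_ifs; exacts [hρ 3, by simp]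
    have h_f : padicNorm p ((fq p ((s : ℤ) + 1) : ℚ) - ((fq p ((x : ℤ) + 1) : ℚ) - ((s / p : ℕ) : ℚ)
        + (p : ℚ) * ((s / p : ℕ) : ℚ) * ((((x : ℤ) + 1 : ℤ)) : ℚ) ^ (p - 1))) ≤ (p : ℚ) ^ (-(2 : ℤ)) := by
      have h := padicNorm_fq_shift_two_le (p := p) hp2 ((x : ℤ) + 1) (((s / p : ℕ) : ℤ))
      rw [← hlvl] at h
      push_cast at h ⊢
      exact h
    have h_kp : padicNorm p (((((s : ℤ) + 1 : ℤ)) : ℚ) ^ (p - 1) - ((((x : ℤ) + 1 : ℤ)) : ℚ) ^ (p - 1)) ≤ (p : ℚ) ^ (-(1 : ℤ)) := by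
      have h := padicNorm_pow_pred_shift_le (p := p) ((x : ℤ) + 1) (((s / p : ℕ) : ℤ))
      rw [← hlvl] at h
      exact h
    have hM := model_reduction (p := p) hg hφ hφs (hρ 1) hρ2n hρ3n hl hF hf (padicNorm_int_pow_le_one _ _)
      (padicNorm_int_pow_le_one _ _) (padicNorm_gHat_sub_second_le b hp2 hx hs) (padicNorm_phiHat_sub_le b hp2 hs) h_f h_kp
    have hκcast : ((((x : ℤ) + 1) ^ (p - 1) : ℤ) : ℚ) = ((((x : ℤ) + 1 : ℤ)) : ℚ) ^ (p - 1) := by push_cast; ring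
    rw [hκcast] at h2
    -- combine: actual − (−p)^{E+3}·gs·BX, then (−p)^{E+3}·(gs·BX − g·MD)
    have hX : padicNorm p ((-(p : ℚ)) ^ (E + 3)) ≤ (p : ℚ) ^ (-(E + 3)) := padicNorm_neg_p_zpow _
    have hXM := padicNorm_mul_le hX hM
    rw [show -(E + 3) + -(2 : ℤ) = -(E + 5) by ring] at hXM
    -- algebra: regroup the goal
    have e : ∀ (t0 t1 t2 X gs g a0 a1 a2 MD : ℚ),
        t0 + (t1 + (t2 + Rest)) - X * (g * MD) =
          Rest + ((t0 - X * (gs * a0)) + (t1 - X * (gs * a1)) + (t2 - X * (gs * a2)))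
            + X * (gs * (a0 + a1 + a2) - g * MD) := by
      intros; ring
    rw [e]
    refine fo_add (fo_add hRestle (fo_add (fo_add h0 h1) h2)) hXM
  · rw [if_neg hspole, mul_zero, mul_zero, sub_zero, sum_eq_zero (fun o ho => by
      rw [pfData_eq_zero_of_netExp_nonneg b hb hsn (by omega) (mem_range.1 ho), zero_mul]), padicNorm.zero]
    exact zpow_p_nonneg _

end Assembly

/-! ### The classwise second `𝒦`-digit -/

/-- **THE CLASSWISE SECOND `𝒦`-DIGIT (`E_x ≤ −4`)**: for `b` in the polytope, a window prime `p ≥ 5` (`b₀ + 2 < p²`) and a pole class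
`x < p` with `E_x ≤ −4` (a class of exponent `≤ −4` has poles automatically; no pole-count hypothesis is needed),
`‖𝒦_x − (−p)^{E_x+3} ĝ_x (ĉ_x − p φ_x ĉ₂_x)‖_p ≤ p^{−(E_x+5)}`.  (The `𝒦`-twin of `secondDigitW_holds`; false at `E_x = −3`.) -/
theorem secondDigitK (b : ℕ → ℤ) (hb : InPolytope b) (hp5 : 5 ≤ p) (hwin : (b 0 + 2 : ℤ) < (p : ℤ) ^ 2)
    {x : ℕ} (hx : x < p) (hE : classExp b p x ≤ -4) :
    padicNorm p (classK b p x - (-(p : ℚ)) ^ (classExp b p x + 3) * gHat b p x *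
        (cHat b p x - (p : ℚ) * phiHat b p x * cHat2 b p x)) ≤ (p : ℚ) ^ (-(classExp b p x + 5)) := by
  have hprime := hp.out
  obtain ⟨hS1, hS2, hS3⟩ := rhoResidueIdentities_holds b p x hb hprime hp5 hwin hx
  have hS1' := hS1 (by omega)
  have hS2' := hS2 (by omega)
  have hS3' := hS3 (by omega)
  rw [if_neg (show ¬ classExp b p x = -3 by omega)] at hS3'
  rw [classPoles, sum_filter] at hS1' hS2' hS3'
  set E := classExp b p x with hE
  set g := gHat b p x with hg
  set φ := phiHat b p x with hφ
  set F : ℚ := (fq p ((x : ℤ) + 1) : ℚ) with hF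
  set κ : ℚ := ((((x : ℤ) + 1 : ℤ)) : ℚ) ^ (p - 1) with hκ
  set P : ℚ := (p : ℚ) with hP
  -- the model term and its pointwise decomposition
  set MD : ℕ → ℚ := fun s => if netExp b s < 0 then
      ((classRho b p s 1 * (F - ((s / p : ℕ) : ℚ)) ^ 2
          - 2 * (F - ((s / p : ℕ) : ℚ)) * (if netExp b s ≤ -2 then classRho b p s 2 else 0))
        + P * (-((s / p : ℕ) : ℚ) * φ *
            (classRho b p s 1 * (F - ((s / p : ℕ) : ℚ)) ^ 2
              - 2 * (F - ((s / p : ℕ) : ℚ)) * (if netExp b s ≤ -2 then classRho b p s 2 else 0))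
          - φ * (if netExp b s ≤ -2 then classRho b p s 2 else 0) * (F - ((s / p : ℕ) : ℚ)) ^ 2
          + 2 * ((s / p : ℕ) : ℚ) * κ * classRho b p s 1 * (F - ((s / p : ℕ) : ℚ))
          - 2 * ((s / p : ℕ) : ℚ) * κ * (if netExp b s ≤ -2 then classRho b p s 2 else 0)
          + 2 * κ * (F - ((s / p : ℕ) : ℚ)) * (if netExp b s ≤ -2 then classRho b p s 2 else 0)
          + 2 * φ * (F - ((s / p : ℕ) : ℚ)) * (if netExp b s ≤ -3 then classRho b p s 3 else 0)
          - 2 * κ * (if netExp b s ≤ -3 then classRho b p s 3 else 0)))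
     else 0 with hMD
  set T1 : ℕ → ℚ := fun q => if netExp b q < 0 then
      ((((q / p : ℕ) : ℚ)) ^ 2 * classRho b p q 1
        + (if netExp b q ≤ -2 then 2 * ((q / p : ℕ) : ℚ) * classRho b p q 2 else 0)) else 0 with hT1
  set T2 : ℕ → ℚ := fun q => if netExp b q < 0 then
      ((((q / p : ℕ) : ℚ)) ^ 3 * classRho b p q 1
        + (if netExp b q ≤ -2 then 3 * (((q / p : ℕ) : ℚ)) ^ 2 * classRho b p q 2 else 0)
        + (if netExp b q ≤ -3 then 2 * ((q / p : ℕ) : ℚ) * classRho b p q 3 else 0)) else 0 with hT2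
  set R1 : ℕ → ℚ := fun q => if netExp b q < 0 then classRho b p q 1 else 0 with hR1
  set R2 : ℕ → ℚ := fun q => if netExp b q < 0 then
      ((if netExp b q ≤ -2 then classRho b p q 2 else 0) + ((q / p : ℕ) : ℚ) * classRho b p q 1) else 0 with hR2
  set R3 : ℕ → ℚ := fun q => if netExp b q < 0 then
      ((if netExp b q ≤ -3 then classRho b p q 3 else 0)
          + 2 * ((q / p : ℕ) : ℚ) * (if netExp b q ≤ -2 then classRho b p q 2 else 0)
          + (((q / p : ℕ) : ℚ)) ^ 2 * classRho b p q 1) else 0 with hR3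
  have hpt : ∀ q ∈ classSet b p x, MD q = T1 q - P * φ * T2 q + F ^ 2 * R1 q
      + (-2 * F + 2 * P * κ * F - P * φ * F ^ 2) * R2 q + (2 * P * φ * F - 2 * P * κ) * R3 q := by
    intro q _
    simp only [hMD, hT1, hT2, hR1, hR2, hR3]
    split_ifs <;> ring
  have hsumMD : ∑ q ∈ classSet b p x, MD q = cHat b p x - P * φ * cHat2 b p x := by
    rw [sum_congr rfl hpt, sum_add_distrib, sum_add_distrib, sum_add_distrib, sum_sub_distrib, ← mul_sum, ← mul_sum,
      ← mul_sum, ← mul_sum, cHat_eq_sum_classSet, cHat2_eq_sum_classSet]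
    simp only [hR1, hR2, hR3] at *
    rw [hS1', hS2', hS3']
    ring
  -- split `𝒦_x − (−p)^{E+3} g (ĉ − pφĉ₂)` into the point terms
  have hsplit : classK b p x - (-(p : ℚ)) ^ (E + 3) * g * (cHat b p x - P * φ * cHat2 b p x) =
      ∑ q ∈ classSet b p x, ((∑ o ∈ range 6, pfData b o q * (((taylorTT p o ((q : ℤ) + 1) : ℤ) : ℚ) - if o = 2 then 1 else 0))
        - (-(p : ℚ)) ^ (E + 3) * (g * MD q)) := by
    rw [← hsumMD, classK, mul_sum, ← sum_sub_distrib]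
    exact sum_congr rfl (fun q _ => by ring)
  rw [hsplit]
  refine padicNorm.sum_le' (fun q hq => ?_) (zpow_p_nonneg _)
  have h := kTerm b hb hp5 hwin hx hq
  simp only [hMD]
  exact h

end Summit.KontsevichZagierPeriods.Zeta5Search.SecondOrder

end
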